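import Mathlib
import HarnessLib
import HarnessLib.Audit
import Summits.NavierStokesRegularity.Statement
import Literature.Analysis.FluidPDE.ClassicalSolution
import Literature.Analysis.FluidPDE.LerayHopf
import Literature.Analysis.FluidPDE.SelfSimilar
import Literature.Analysis.FluidPDE.SuitableWeak
import Literature.Analysis.FluidPDE.NSWave0
import Literature.Analysis.FluidPDE.AxisymmetricEuler
import Literature.Analysis.FluidPDE.LocalTypeI
import Literature.Barriers.NavierStokesRegularity.AxisymmetricTypeIExclusion
import Summits.NavierStokesRegularity.NavierStokesRegularity.Theorems.AdiabaticEddyClayUniqueness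
import HarnessLib.Audit.Status.Attr

/-!
Route: QuantisedSymmetry

# Route QuantisedSymmetry — NavierStokesRegularity, NEGATIVE side ("viscosity quantises symmetry";
card quantised-rotational-symmetry)

## Thesis X⁻ = PolyhedralDssProfileExists ("it suffices to exhibit")
In words: there is a finite IRREDUCIBLE rotation group G ⊂ SO(3) — up to conjugacy a chiral
polyhedral group T, O or I — and a nontrivial ancient mild solution u of NS (ν = 1) on ℝ³×(−∞,0)
with measurable slices which is λ-discretely self-similar for some λ > 1, obeys the Type-I bound
|u(x,t)| ≤ C₀/(|x|+√−t), and is G-equivariant about its singular point: u(t, g x) = g u(t, x) for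
all g ∈ G.
Lean (elaborates, Sketch2.lean rc 0): ∃ G : Subgroup (ℝ³ ≃ₗᵢ[ℝ] ℝ³), Finite G ∧ (∀ g ∈ G,
LinearMap.det g = 1) ∧ (∀ V : Submodule ℝ ℝ³, (∀ g ∈ G, ∀ v ∈ V, g v ∈ V) → V = ⊥ ∨ V = ⊤) ∧ ∃ c >
1, ∃ u, IsAncientMildSolution 1 u ∧ (∀ t<0, AEStronglyMeasurable (u t)) ∧ IsDiscretelySelfSimilar c
u ∧ (∃ C₀, HasTypeIDecay C₀ u) ∧ (∀ g ∈ G, ∀ t x, u t (g x) = g (u t x)) ∧ ¬ (∀ t<0, u t =ᵐ 0)  — a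
G-equivariant counterexample to `Literature.Analysis.FluidPDE.TypeIDSSLiouville c` (Tsai2018 Conj.
8.8–8.9), placed in the sector this route argues is the only admissible highly symmetric one.

## Assembly X⁻ → ¬NavierStokesRegularity (deciding theorem `closes`, rev 2)
X⁻ → PolyhedralTruncationBridge (per-sector bridge, stmt-11331: for every finite irreducible G,
every λ > 1 and every G-equivariant Type-I λ-DSS nontrivial ancient mild profile ⇒ a rapidly
decaying datum whose Leray–Hopf classical solution is maximal with finite lifespan, X5a) →
ClayUniqueness (X5b, stmt-0153) → ¬NavierStokesRegularity. PROVED (glue.lean = `closes`, inline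
`blowup_assembly` argument: Clay (A) on the datum u 0, ClayUniqueness glues the global Clay solution
to the blowing-up one on [0,T), its restriction to [0,T+1) is a smooth extension past T,
contradicting maximality). The route no longer wants the shared sector-agnostic bridge stmt-0901
(¬TypeIDSSLiouvilleConjecture ⇒ X5a; it implies this bridge in three lines, so a proof of 0901
closes #4) nor any named Literature fact: the engine SereginSverak2009 Thm 3.1 enters only as the
INLINED antecedent of Lemma Q.

## Two-layer plan (D-0019)
Layer 1 (ranked cruxes): #2 PolyhedralDssProfileExists (X⁻, the load-bearing existence claim); #3
PolyhedralTypeILiouville (its kill switch: the T/O/I case of the KNSS Liouville conjecture for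
bounded ancient mild solutions with Type-I decay — proved ⇒ route refuted via support
LiouvilleKillsProfile); #4 PolyhedralTruncationBridge (the per-sector truncation, 1 neutral symmetry
Floquet mode instead of 7); #5 QuantisedOrder (Lemma Q: C_n-symmetry of order n ≥ N(C,M) is as fatal
to a Type-I singularity as axisymmetry — the selection rule; stated as the conditional `SS2009 Thm
3.1 ⇒ order bound` over the Albritton–Barker suitable class, provable now from in-tree
SuitableCompactness_holds + PersistenceOfSingularities_holds + SO(2)-averaging + parabolic zoom).
Support: ClayUniqueness (shared), LiouvilleKillsProfile (#3 → ¬#2). Layer 2 (only after something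
closes): split of #2 into (profile numerics certificate in the I-sector | equivariant Floquet count
| existence by continuation); split of #4 into (equivariant similarity-variable linear theory |
finite-codimension truncation | removal of the codimension by the 1-mode count).

Rationale: WHY THIS LINE. Card quantised-rotational-symmetry made summit-bearing on the negative side. ENGINE:
SereginSverak2009 Thm 3.1 (arXiv:0804.1803) — an axisymmetric Type-I singularity is regular; in tree
it is the XL named fact Literature.Barriers.NavierStokesRegularity.AxisymmetricTypeIExclusion
(reduced to 3 remaining leaves in AxisymmetricTypeIExclusionProofs.lean), and this route CONSUMES IT
ONLY AS THE INLINED ANTECEDENT of Lemma Q (rfl-equal; no dependency, rev 2). QUANTISATION (crux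
QuantisedOrder = Lemma Q): compactness of suitable weak solutions with bounded L³×L^{3/2} norms
(Lin1998 = AlbrittonBarker2019 arXiv:1811.00502 Lemma 2.2, in tree SuitableCompactness_holds) and
persistence of singularities (RusinSverak2011 Lemmas 2.1–2.2 = AlbrittonBarker2019 Prop 2.3, in tree
PersistenceOfSingularities_holds — needs only the L³×L^{3/2} bound, whence N = N(C,M)) turn a
sequence of C_{n_k}-symmetric Type-I(C) singular suitable solutions in the unit parabolic ball, n_k
→ ∞, into an a.e.-axisymmetric Type-I singular limit; SO(2)-averaging makes it pointwise
axisymmetric, a parabolic zoom puts it on the Seregin–Šverák cylinder, and the engine kills it. So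
the stabiliser of a Type-I singularity is a finite subgroup of O(3) whose rotation orders are < N:
cyclic/dihedral families of bounded order, or POLYHEDRAL (orders ≤ 5) — the maximally symmetric
admissible classes. SECTOR SELECTION by representation theory: T, O, I act irreducibly on ℝ³, which
is both the translation and the rotation (adjoint) representation, so in a polyhedral sector a λ-DSS
orbit of Leray's similarity flow keeps 1 neutral symmetry Floquet mode (orbit tangent) of the 7 (3
unstable translations e^{s/2}, 3 neutral rotations, 1 tangent) that burden the sector-agnostic
bridge of DssFarFieldSlaving (stmt-0901); Schur forces u(0,t)=0, ∇u(0,t)=0 and u ∥ ω ∥ e on every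
rotation axis (14/26/62 rays for T/O/I). Axisymmetric sectors are forbidden (engine), large cyclic
sectors are forbidden (Lemma Q), mirror sectors carry extra conservation laws (card
mirror-walls-weyl-chamber-equivariant, route MirrorChamber); the CHIRAL polyhedral sector is the
least constrained place where the wanted Type-I DSS profile (Tsai2018 Conj 8.8–8.9; Blowup #5) can
live with the best-conditioned linearisation, and helicity / the helical decomposition stay
G-equivariantly meaningful there (LeiLin2011, arXiv:1505.00142). Imported areas:
compactness–rigidity (quantifying a qualitative Liouville-type theorem, as in gap theorems of
geometric analysis); finite-group representation theory (irreducibility, Schur) for the Floquet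
bookkeeping; no probabilistic/spectral reformulation (none touches the ∀-datum gap; here the target
is ∃).
RANKED CRUXES. #2 PolyhedralDssProfileExists — X⁻ (why it might fail: #3 may hold; Tsai's conjecture
may hold outright — λ≈1 removed under this bound, ChaeWolf2017RemovingDSS Thm 1.3; λ-continuous
profiles vanish, NecasRuzickaSverak1996, Tsai1998). #3 PolyhedralTypeILiouville — kill switch,
special case of TypeILiouville's (L) stmt-0057 with Type-I decay added (why: X⁻; honest status
'structure without engine': Schur jet, radial axes, zero-mean superhelicity are not coercive;
KNSS2009 §1). #4 PolyhedralTruncationBridge (stmt-11331) — per-sector truncation: G-profile ⇒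
Schwartz-class finite-lifespan Leray–Hopf classical solution, the truncation being done
G-equivariantly (why: even with 1 neutral symmetry mode the orbit need not be hyperbolic —
non-symmetry Floquet multipliers may accumulate at the unit circle, P∇· unbounded on L²(γ); only the
LOCAL/forced transfer is in print, AlbrittonBarker2019 Thm 1.1 / Rem 4.3; JiaSverak2014/2015 forward
twin). #5 QuantisedOrder — Lemma Q as the conditional `SS2009 Thm 3.1 (inlined) ⇒ order bound
N(C,M)` over the Albritton–Barker suitable class in Q(0,1) (why: low truth-risk; as stated, the
a.e.-axisymmetric limit must be modified on a null set to meet the engine's pointwise IsAxisymmetric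
while staying a distributional pair with the same p, and zoomed from Q(0,R) to the SS cylinder; N
ineffective, AlbrittonBarker2019 Rem 3.2; n = 0, 1 are vacuous symmetries so N ≥ 2).
SUPPORT. ClayUniqueness (shared stmt-0153, X5b). LiouvilleKillsProfile (#3 → ¬#2: u(·−1,·) is
bounded by C₀, ancient mild (IsMildNSSolutionBetween.comp_add_right), Type-I, G-equivariant ⇒ a.e.
zero for t<−1 ⇒ everywhere by DSS rescaling; checked `example (hL : LiouvilleKillsProfile) (h3 :
PolyhedralTypeILiouville) : ¬PolyhedralDssProfileExists := hL h3`). Assembly (= the type of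
`closes`; `Assembly_holds := closes`). Replaced/dropped at rev 2: DssTruncationBridge (stmt-0901,
kept by its 5 other routes; it implies #4 in three lines) and ProfileNegatesTsai (stmt-1407, only
fed 0901) — both named the wall constant TypeIDSSLiouvilleConjecture, an undeclared conjecture in
the cone; QuantisedOrder rev-1 form (antecedent = the named XL fact) superseded by the inlined form.
KILL CRITERIA. #3 proved ⇒ #2 refuted (LiouvilleKillsProfile) ⇒ close
refuted:PolyhedralDssProfileExists (Lemma Q survives as support for TypeILiouville /
SymmetryModuliCount: 'no highly symmetric and no polyhedral Type-I singularity').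
TypeIDSSLiouvilleConjecture proved (Blowup #5 refuted) ⇒ same. #4 refuted (a G-profile all of whose
Schwartz truncations are global) ⇒ pivot with DssFarFieldSlaving to the hyperbolic conditional
bridge (1 neutral mode here) or close. NoBlowup stmt-0054 proved ⇒ moot. Lemma Q refuted would
exhibit near-axisymmetric Type-I singular suitable solutions with bounded norms escaping SS2009 —
re-examine the engine's statement (it is the antecedent), keep #2–#4.
NOT DECOMPOSED YET. The finite census L(C) (closed-subgroup lemma + CKN 𝒫¹(S)=0 for axes missing the
point + classification of finite subgroups of O(3): bookkeeping; Mathlib lacks the classification);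
EFFECTIVE N(C,M) (a quantitative SS2009; open — the SS proof argues by contradiction through KNSS
Thm 5.3); δ-robust collars; the numerical hunt for X⁻ (harmonic balance / Newton–Krylov in the
I-invariant sector of Leray's similarity equation seeded by 62-ray 'vortex star' fields; null tests
NRŠ/Tsai, Lemma Q) — a kit job inside #2, not an item; which of T/O/I — #2/#3/#4 quantify over all
three; the equivariant linear theory of #4 (layer 2 after #2 or 0901 moves).
CHEAPEST FALSIFIER. Theorem-level: PolyhedralTypeILiouville (#3) — one Liouville theorem in the
T/O/I class with Type-I decay kills X⁻ outright (LiouvilleKillsProfile is already checked); the two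
cheap ends are dead already (λ-continuous: NecasRuzickaSverak1996/Tsai1998; λ → 1⁺ at fixed C₀:
ChaeWolf2017RemovingDSS Thm 1.3, so any witness has λ ≥ λ_*(C₀)). Evidence-level (kit, inside #2):
equivariant harmonic-balance / Newton–Krylov continuation in the I-invariant sector of Leray's
similarity equation for λ ∈ [λ_*(C₀), 4] — no periodic orbit and no near-neutral equivariant Floquet
direction at any seed retires the habitat claim's only positive evidence.
NUMBERS. Rotation orders in T/O/I ≤ 5; |T|,|O|,|I| = 12, 24, 60; axis rays 14/26/62; symmetry
Floquet modes 7 → 1; proved cases of (L): 3 (KNSS2009 Thms 5.1–5.3) + SS2009 Type-I axisymmetric;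
Lemma Q inputs in tree: SuitableCompactness_holds, PersistenceOfSingularities_holds
(LocalTypeIProofs / LocalTypeIPersistenceHolds), nsZoom scaling (LocalTypeIScaling,
LocalTypeIReverseZoom), engine = 1 inlined antecedent (XL fact, 3 leaves left: OffAxisBound,
LocalHolderBound, KNSS Thm 5.3). Items at rev 2: 7 = 4 cruxes + 2 support + 1 assembly; 1 shared
(stmt-0153); 0 named Literature facts in the cone (target).

Novelty: NOVELTY (searched 2026-08-15: hybrid/vsearch for Lemma Q in prose and 'point group/octahedral/Kida
symmetry NS singularity'; crossref/zbmath 'icosahedral symmetry NS self-similar', 'Pelz symmetry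
blow-up', 'm-fold symmetry nearly axisymmetric NS', 'equivariant NS Liouville finite group'; lit
frontier/bridges; galaxyd down; card's refuter audit; log in NOTES). Nearest prior art:
SereginSverak2009 arXiv:0804.1803 Thm 3.1 (qualitative axisymmetric Type-I exclusion — the engine
being quantised); AlbrittonBarker2019 arXiv:1811.00502 Lemma 2.2/Prop 2.3 + RusinSverak2011
(compactness, persistence of singularities); Pelz2001 doi:10.1017/s0022112001005298 and
doi:10.1016/s0169-5983(03)00039-x (octahedral symmetry as computational device; nothing proved about
admissible orders); Xue 2015 doi:10.1088/0951-7715/28/10/3695 and Tsai2018 ch.8 (DSS, no point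
groups); Elgindi–Jeong arXiv:1610.09701 (m-fold symmetry as regularising parameter, Euler); in tree:
route DssFarFieldSlaving (sector-agnostic bridge, 7 symmetry Floquet modes), cards
mirror-walls-weyl-chamber-equivariant (reflection groups), discrete-stabiliser-dimension-count (no
order bound). Delta: (i) an ORDER bound N(C,M) on rotational symmetry of a Type-I singularity
(QuantisedOrder) — not found in print; (ii) the finite irreducible (chiral polyhedral) sector as the
maximal admissible habitat of a Type-I DSS profile, with the representation-theoretic count 7→1 of
symmetry modes; (iii) PolyhedralTypeILiouville as the exact kill swi  [refs: 10.1017/s0022112001005298, 10.1016/s0169-5983(03, 10.1088/0951-7715/28/10/3695, 0804.1803, 1811.00502, 1610.09701, doi:10.1017/s0022112001005298, doi:10.1016/s0169-5983, doi:10.1088/0951-7715/28/10/3695, SereginSverak2009, AlbrittonBarker2019, RusinSverak2011, Pelz2001, Tsai2018]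

Barriers (technique_class: compactness-rigidity, blowup-construction, type-I-blowup-rate): technique_class: compactness-rigidity, blowup-construction, type-I-blowup-rate
- Literature.Barriers.NavierStokesRegularity.AxisymmetricTypeIExclusion: CONSUMED as the engine of
QuantisedOrder (explicit hypothesis; its class — distributional pair in the unit cylinder, u ∈ L³, p
∈ L^{3/2}, pointwise axisymmetric slices, a.e. Type-I bound — is met by the SO(2)-averaged
compactness limit); for X⁻ it forbids the axisymmetric sector, hence a FINITE irreducible sector
(T/O/I are not axisymmetric; their rotation orders ≤ 5 must stay below N(C,M), which is ineffective
— no contradiction, no comfort).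
- Literature.Barriers.NavierStokesRegularity.LeraySelfSimilarBlowupExclusion: applies to
λ-continuous profiles only; X⁻ is λ-DSS, λ > 1 outside the Chae–Wolf window (ChaeWolf2017RemovingDSS
Thm 1.3, in #2's why-might-fail).
- Literature.Barriers.NavierStokesRegularity.CriticalNormBlowupNecessity: respected — the bridge's
blow-up has ‖u(t)‖_{L³} → ∞ with weak-L³ bounded, the Type-I signature the barrier leaves open.
- Literature.Barriers.NavierStokesRegularity.SingularSetDimensionBound: respected and used — one
singular point; a symmetry axis missing it would create a singular circle (𝒫¹ > 0), so stabilisers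
are point groups about the singular point.
- Literature.Barriers.NavierStokesRegularity.TaoAveragedBlowup and
Literature.Barriers.NavierStokesRegularity.EnergySupercriticality: symmetry alone evades nothing (an
averaged bilinear form can be kept O(3)-equivariant); Lemma Q is exactly a

Novelty grade: new-combination — ROUTE REVIEW + grade (refuter route-review, 2026-08-15; full review attached as evidence on stmt-1404/1406). Grade new-combination: (i) the qualitative axisymmetric Type-I exclusion of SereginSverak2009 (in-tree barrier AxisymmetricTypeIExclusion) QUANTIFIED to an order bound N(C,M) on rotational sy (refuter refuter-rreview-route-QuantumAdvantage-M-4fd66191-0, 2026-08-15T12:20:39Z; prior: SereginSverak2009 arXiv:0804.1803 Thm 3.1, AlbrittonBarker2019 arXiv:1811.00502 Lemma 2.2 / Prop 2.3, RusinSverak2011 Lemmas 2.1-2.2, Lin1998, ChaeWolf2017RemovingDSS arXiv:1610.09464 Thm 1.3, Tsai2018 ch.8 / Tsai1998, Pelz2001 doi:10.1017/s0022112001005298, ElgindiJeong arXiv:1610.09701, KNSS2009)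

History (route lifecycle, newest last):
- 2026-08-15T17:00:05Z · rev 2: restated QuantisedOrder (stmt-NavierStokesRegularity-1406), Assembly (stmt-NavierStokesRegularity-1409) — route-choice repair (rchoice seat 36073b6c), step 2/2 — RE-ROUTED around Literature.Barriers.NavierStokesRegularity.AxisymmetricTypeIExclusion (XL named fact; n (planner-rchoice-NavierStokesRegularity-Quantis-36073b6c-0)
- 2026-08-15T17:00:05Z · rev 2: dropped ProfileNegatesTsai — route-choice repair (rchoice seat 36073b6c), step 2/2 — RE-ROUTED around Literature.Barriers.NavierStokesRegularity.AxisymmetricTypeIExclusion (XL named fact; n (planner-rchoice-NavierStokesRegularity-Quantis-36073b6c-0)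
- 2026-08-25T14:37:16Z · DORMANT — reconciler: no traction for 7.8 d (last activity item-evidence-added at 2026-08-17T19:17:12Z); parked, not closed — `ledger route dormant route-NavierStokesRegu (operator:999:1782747)
- 2026-08-28T00:51:23Z · REACTIVATED — reconciler: reactivated — activity item-evidence-added at 2026-08-27T23:50:40Z after parking at 2026-08-25T14:37:16Z (operator:999:610667)

sub-problem: NavierStokesRegularity · status: open · opened planner-plancard-NavierStokesRegularity-Navie-8ca50209-0 2026-08-15T10:55:42Z · rev 4 · ledger route-NavierStokesRegularity-QuantisedSymmetry
GENERATED by the gate from the ledger (D-0016/17). Provers cite these decls: `theorem foo : Summit.NavierStokesRegularity.NavierStokesRegularity.Theses.QuantisedSymmetry.<Decl> := …` in Summits/NavierStokesRegularity/NavierStokesRegularity/Theorems/<Name>.lean.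
-/

namespace Summit.NavierStokesRegularity.NavierStokesRegularity.Theses.QuantisedSymmetry

open scoped BigOperators Topology Manifold Classical MeasureTheory ProbabilityTheory Matrix InnerProductSpace ComplexConjugate ContinuousMap
open Filter Set Function TopologicalSpace MeasureTheory

attribute [summit_statement] _root_.NavierStokesRegularity

open Literature.NS

/-- item stmt-NavierStokesRegularity-1404 · crux · rank 2 · open · by planner
why it might fail: The polyhedral Type-I Liouville (#3) may hold, or Tsai's DSS Liouville conjecture outright: λ≈1 is removed under exactly this Type-I bound (ChaeWolf2017RemovingDSS Thm 1.3), λ-continuous profiles vanish (NecasRuzickaSverak1996, Tsai1998); no backward DSS existence mechanism is in print.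
sources: Tsai2018, ChaeWolf2017RemovingDSS, NecasRuzickaSverak1996, Tsai1998, BradshawTsai2017CPDE, SereginSverak2009
[crux] X⁻ (thesis; card quantised-rotational-symmetry Q4): there is a finite irreducible proper
rotation group G ≤ SO(3) (≅ T, O or I up to conjugacy: the chiral polyhedral groups — 'finite +
irreducible on ℝ³' characterises them) and a nontrivial ancient mild solution (ν=1, measurable
slices) on ℝ³×(−∞,0), λ-DSS for some λ>1, with Type-I bound |u| ≤ C₀/(|x|+√−t), G-equivariant about
the origin (u(t,gx) = g u(t,x)). A G-equivariant counterexample to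
Literature.Analysis.FluidPDE.TypeIDSSLiouville λ, hence to TypeIDSSLiouvilleConjecture (support
ProfileNegatesTsai) = Blowup #5 / DssFarFieldSlaving H1 placed in the best-conditioned sector: G
acts irreducibly on the translation and rotation representations, so the DSS orbit of Leray's
similarity flow has 1 neutral symmetry Floquet mode (orbit tangent) instead of 7; Schur: u(0,t)=0,
∇u(0,t)=0, and u ∥ ω ∥ e on each of the 14/26/62 axis rays; axisymmetric sectors are forbidden
(SereginSverak2009), cyclic sectors of order ≥ N(C,M) by QuantisedOrder. Hunt: harmonic balance /
Newton–Krylov in the I-invariant sector seeded by 62-ray 'vortex star' fields; null tests: steady ⇒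
0 (Tsai1998), NRŠ, Lemma Q. Why it might fail: see why_might_fail. -/
@[route_item "route-NavierStokesRegularity-QuantisedSymmetry", crux]
def PolyhedralDssProfileExists : Prop :=
  ∃ G : Subgroup (EuclideanSpace ℝ (Fin 3) ≃ₗᵢ[ℝ] EuclideanSpace ℝ (Fin 3)), Finite G ∧ (∀ g ∈ G, LinearMap.det (g.toLinearEquiv : EuclideanSpace ℝ (Fin 3) →ₗ[ℝ] EuclideanSpace ℝ (Fin 3)) = 1) ∧ (∀ V : Submodule ℝ (EuclideanSpace ℝ (Fin 3)), (∀ g ∈ G, ∀ v ∈ V, g v ∈ V) → V = ⊥ ∨ V = ⊤) ∧ ∃ c : ℝ, 1 < c ∧ ∃ u : ℝ → EuclideanSpace ℝ (Fin 3) → EuclideanSpace ℝ (Fin 3), Literature.Analysis.FluidPDE.IsAncientMildSolution 1 u ∧ (∀ t < 0, AEStronglyMeasurable (u t) volume) ∧ Literature.Analysis.FluidPDE.IsDiscretelySelfSimilar c u ∧ (∃ C₀ : ℝ, Literature.Analysis.FluidPDE.HasTypeIDecay C₀ u) ∧ (∀ g ∈ G, ∀ t x, u t (g x) = g (u t x))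 ∧ ¬ (∀ t < 0, u t =ᵐ[volume] 0)

/-- item stmt-NavierStokesRegularity-1405 · crux · rank 3 · open · by planner
why it might fail: A polyhedrally-equivariant Type-I DSS profile (crux #2) refutes it; no coercive engine is known for finite stabilisers — Schur jet u(0)=∇u(0)=0, radial axes and zero-mean superhelicity are structure only, and (L) is open even for bounded steady flows (KNSS2009 §1).
sources: KNSS2009, SereginSverak2009, AlbrittonBarker2019, LeiLin2011, ChaeWolf2017RemovingDSS
[crux] KILL SWITCH (card Q3, positive side): for every finite irreducible proper rotation group G ≤
SO(3) (T/O/I), every bounded ancient mild solution on ℝ³×(−∞,0) (ν=1, measurable slices, the KNSS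
class of LiouvilleConjectureNS) with Type-I space–time decay |u| ≤ C₀/(|x|+√−t) which is
G-equivariant about the origin vanishes a.e. on every slice. The T/O/I case of the KNSS Liouville
conjecture (L) = TypeILiouville stmt-0057, weakened by the Type-I decay hypothesis
(AlbrittonBarker2019's weak version of (L)); implies ¬#2 (support LiouvilleKillsProfile: time-shift
+ DSS rescaling). Available structure: Schur (u and ∇u vanish at the centre for all t), on every
rotation axis u ∥ ω ∥ axis (prescribed heteroclinic skeleton of the profile flow through the apex),
G-equivariant helical decomposition u = u₊ + u₋ with the Lei–Lin/Lei–Lin–Zhou critical identities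
(void in mirror classes, available here), Type-I decay ⇒ energy methods at infinity. Proved ⇒ route
closes refuted and 'no polyhedral Type-I singularity' joins QuantisedOrder as support for route
TypeILiouville. Why it might fail: see why_might_fail. [sources: KNSS2009 Thms 5.1–5.3, §1;
SereginSverak2009; AlbrittonBarker2019 Thm 1.1; L -/
@[route_item "route-NavierStokesRegularity-QuantisedSymmetry"]
def PolyhedralTypeILiouville : Prop :=
  ∀ G : Subgroup (EuclideanSpace ℝ (Fin 3) ≃ₗᵢ[ℝ] EuclideanSpace ℝ (Fin 3)), Finite G → (∀ g ∈ G, LinearMap.det (g.toLinearEquiv : EuclideanSpace ℝ (Fin 3) →ₗ[ℝ] EuclideanSpace ℝ (Fin 3)) = 1) → (∀ V : Submodule ℝ (EuclideanSpace ℝ (Fin 3)), (∀ g ∈ G, ∀ v ∈ V, g v ∈ V) → V = ⊥ ∨ V = ⊤) → ∀ u : ℝ → EuclideanSpace ℝ (Fin 3) → EuclideanSpace ℝ (Fin 3), Literature.Analysis.FluidPDE.IsBoundedAncientMildSolution 1 u → (∀ t < 0, AEStronglyMeasurable (u t) volume) → (∃ C₀ : ℝ, Literature.Analysis.FluidPDE.HasTypeIDecay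 C₀ u) → (∀ g ∈ G, ∀ t x, u t (g x) = g (u t x)) → ∀ t < 0, u t =ᵐ[volume] 0

/-- item stmt-NavierStokesRegularity-11331 · crux · rank 4 · closed · proved by Summit.NavierStokesRegularity.NavierStokesRegularity.Theorems.quantisedSymmetry_polyhedralTruncationBridge_proof @ b834ed6c416d (prover) · by planner
why it might fail: No profile ⇒ finite-energy blow-up transfer is in print (only the LOCAL one, AlbrittonBarker2019 Thm 1.1); without hyperbolicity the DSS orbit may carry Floquet multipliers accumulating at the unit circle (far-field essential spectrum) even with the 6 translation/rotation modes removed.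
sources: JiaSverak2015, JiaSverak2014, BradshawTsai2017CPDE, AlbrittonBarker2019, Tsai2018, ChaeWolf2017RemovingDSS
[crux] PER-PROFILE POLYHEDRAL TRUNCATION BRIDGE (rev 2, route-repair; route-local replacement of the
shared general bridge DssFarFieldSlaving.DssTruncationBridge stmt-NavierStokesRegularity-0901, from
which it follows in three lines — a G-equivariant λ-DSS Type-I profile negates TypeIDSSLiouville λ,
hence Tsai's conjecture — so a proof of 0901 closes this item; the converse is this route's bet that
the invariant sector is EASIER): for every finite irreducible proper rotation group G ≤ SO(3)
(T/O/I), every λ>1 and every nontrivial ancient mild solution u (ν=1, measurable slices) on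
ℝ³×(−∞,0) which is λ-DSS, obeys |u| ≤ C₀/(|x|+√−t) and is G-equivariant about the origin, there are
ν>0, T>0 and a Leray–Hopf CLASSICAL solution (v,p) from a rapidly decaying datum with finite maximal
lifespan T (IsMaximalSmoothSolution ∧ IsLerayHopfOn ∧ HasRapidSpatialDecay (v 0); any ν by scaling)
— X5a of route Blowup. Construction sketch (as for 0901): similarity variables y = x/√(T−t), s =
−log(T−t), U = √(T−t)u; u ↦ s-periodic orbit U_* of ∂_sU = 𝓛U − U·∇U − ∇P, 𝓛 = Δ − ½y·∇ − ½
(self-adjoint with compact resolvent on L²(e^{−|y|²/4})); Type-I decay |y||U_*| ≤ C₀ makes transport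
𝓛-bounded uniformly i -/
@[route_item "route-NavierStokesRegularity-QuantisedSymmetry", crux]
def PolyhedralTruncationBridge : Prop :=
  ∀ G : Subgroup (EuclideanSpace ℝ (Fin 3) ≃ₗᵢ[ℝ] EuclideanSpace ℝ (Fin 3)), Finite G → (∀ g ∈ G, LinearMap.det (g.toLinearEquiv : EuclideanSpace ℝ (Fin 3) →ₗ[ℝ] EuclideanSpace ℝ (Fin 3)) = 1) → (∀ V : Submodule ℝ (EuclideanSpace ℝ (Fin 3)), (∀ g ∈ G, ∀ v ∈ V, g v ∈ V) → V = ⊥ ∨ V = ⊤) → ∀ c : ℝ, 1 < c → ∀ u : ℝ → EuclideanSpace ℝ (Fin 3) → EuclideanSpace ℝ (Fin 3), Literature.Analysis.FluidPDE.IsAncientMildSolution 1 u → (∀ t < 0, AEStronglyMeasurable (u t) volume) → Literature.Analysis.FluidPDE.IsDiscretelySelfSimilar c u → (∃ C₀ : ℝ, Literature.Analysis.FluidPDE.HasTypeIDecay C₀ u) → (∀ g ∈ G, ∀ t x, u t (g x) = g (u t x)) → ¬ (∀ t < 0, u t =ᵐ[volume] 0) → ∃ ν : ℝ, 0 < ν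 ∧ ∃ T : ℝ, 0 < T ∧ ∃ (v : ℝ → EuclideanSpace ℝ (Fin 3) → EuclideanSpace ℝ (Fin 3)) (p : ℝ → EuclideanSpace ℝ (Fin 3) → ℝ), Literature.Analysis.FluidPDE.IsMaximalSmoothSolution ν 0 v p T ∧ Literature.Analysis.FluidPDE.IsLerayHopfOn T ν 0 (v 0) v ∧ Literature.Analysis.FluidPDE.HasRapidSpatialDecay (v 0)

-- `PolyhedralTruncationBridge` holds: proved by `Summit.NavierStokesRegularity.NavierStokesRegularity.Theorems.quantisedSymmetry_polyhedralTruncationBridge_proof` @ b834ed6c416d (its module imports this route file, so no `_holds` link can be stated here).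

-- earlier QuantisedOrder (stmt-NavierStokesRegularity-1406, replaced 2026-08-15T17:00:05Z -> stmt-NavierStokesRegularity-11293): retired by None — Literature.Barriers.NavierStokesRegularity.AxisymmetricTypeIExclusion → ∀ C M : ℝ, ∃ N : ℕ, ∀ n : ℕ, N ≤ n → ∀ (u : ℝ → EuclideanSpace ℝ (Fin 3) → EuclideanSpace ℝ (Fin 3)) (p : ℝ → EuclideanSpace ℝ (Fin 3) → ℝ), Literature.Analysis.FluidPDE.IsDistributio
/-- item stmt-NavierStokesRegularity-11293 · crux · rank 5 · closed · proved by Summit.NavierStokesRegularity.NavierStokesRegularity.Theorems.quantisedSymmetry_quantisedOrder_proof (prover) · by planner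
why it might fail: Low truth-risk (engine antecedent + AB L2.2/Prop 2.3 proved in tree). As stated the a.e.-axisymmetric L³ limit must be modified on a null set to meet the engine's POINTWISE IsAxisymmetric yet stay a distributional pair with the same p, then zoomed from Q(0,R) to the SS cylinder; N ineffective, N ≥ 2
sources: SereginSverak2009, AlbrittonBarker2019, RusinSverak2011, Lin1998, CKN1982
[crux] LEMMA Q, 'viscosity quantises symmetry' (card Q1), RESTATED at rev 2 (route-choice repair):
the engine SereginSverak2009 Thm 3.1 is the INLINED ANTECEDENT (verbatim =
Literature.Barriers.NavierStokesRegularity.AxisymmetricTypeIExclusion by rfl — no dependency on the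
XL named fact; `fun h => …` uses it as a hypothesis, and the unconditional Lemma Q follows the day
AxisymmetricTypeIExclusion_holds lands), and the conclusion is stated over the Albritton–Barker
suitable class in the unit parabolic ball Q(0,1) = (−1,0)×B₁(0): for every Type-I constant C and
norm bound M there is N such that for all n ≥ N every suitable weak solution (u,p) of NS (ν=1) in
Q(0,1) (IsSuitableWeakSolutionInBall 1 0 u p) with ‖u‖_{L³(Q(0,1))} ≤ M, ‖p‖_{L^{3/2}(Q(0,1))} ≤ M
(eLpNorm ≤ ofReal M), C_n-equivariant slices about the x₃-axis (u(t, R_{2π/n}x) = R_{2π/n}u(t,x), t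
∈ (−1,0)) and √(−t)|u| ≤ C a.e. on Q(0,1), is essentially bounded on some Q_r(0,0) (⇔
¬IsBackwardSingularPoint u 0) — the engine's conclusion with 'axisymmetric' replaced by
'C_n-symmetric, n ≥ N(C,M)'. PROOF ROUTE on in-tree theorems (~L): if not, take n_k → ∞ and singular
(u_k,p_k); SuitableCompactness_holds (AB Lemma 2.2 = Lin1998; -/
@[route_item "route-NavierStokesRegularity-QuantisedSymmetry"]
def QuantisedOrder : Prop :=
  (∀ (u : ℝ → EuclideanSpace ℝ (Fin 3) → EuclideanSpace ℝ (Fin 3)) (p : ℝ → EuclideanSpace ℝ (Fin 3) → ℝ), Literature.Analysis.FluidPDE.IsDistributionalNSSolutionOn Literature.Barriers.NavierStokesRegularity.ssCylinderOpens 1 0 u p → (∫⁻ z in Literature.Barriers.NavierStokesRegularity.ssCylinder, ‖u z.1 z.2‖ₑ ^ (3 : ℕ) < ⊤) → (∫⁻ z in Literature.Barriers.NavierStokesRegularity.ssCylinder, ‖p z.1 z.2‖ₑ ^ (3 / 2 : ℝ) < ⊤) → (∀ t ∈ Set.Ioo (-1 : ℝ) 0, Literature.Analysis.FluidPDE.IsAxisymmetric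 (u t)) → (∃ C : ℝ, ∀ᵐ z ∂(volume.restrict Literature.Barriers.NavierStokesRegularity.ssCylinder), Real.sqrt (-z.1) * ‖u z.1 z.2‖ ≤ C) → ∃ r > 0, eLpNorm (Function.uncurry u) ⊤ (volume.restrict (Literature.Analysis.FluidPDE.parabolicCylinder r ((0 : ℝ), (0 : EuclideanSpace ℝ (Fin 3))))) < ⊤) → ∀ C M : ℝ, ∃ N : ℕ, ∀ n : ℕ, N ≤ n → ∀ (u : ℝ → EuclideanSpace ℝ (Fin 3) → EuclideanSpace ℝ (Fin 3)) (p : ℝ → EuclideanSpace ℝ (Fin 3) → ℝ), Literature.Analysis.FluidPDE.IsSuitableWeakSolutionInBall 1 0 u p → eLpNorm (Function.uncurry u) 3 (volume.restrict (Literature.Analysis.FluidPDE.parabolicCylinder 1 (0 : ℝ × EuclideanSpace ℝ (Fin 3)))) ≤ ENNReal.ofReal M → eLpNorm (Function.uncurry p) (3 / 2) (volume.restrict (Literature.Analysis.FluidPDE.parabolicCylinder 1 (0 : ℝ × EuclideanSpace ℝ (Fin 3)))) ≤ ENNReal.ofReal M → (∀ t ∈ Set.Ioo (-1 : ℝ)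 0, ∀ x, u t (Literature.Analysis.FluidPDE.rotZ (2 * Real.pi / n) x) = Literature.Analysis.FluidPDE.rotZ (2 * Real.pi / n) (u t x)) → (∀ᵐ z ∂(volume.restrict (Literature.Analysis.FluidPDE.parabolicCylinder 1 (0 : ℝ × EuclideanSpace ℝ (Fin 3)))), Real.sqrt (-z.1) * ‖u z.1 z.2‖ ≤ C) → ∃ r > 0, eLpNorm (Function.uncurry u) ⊤ (volume.restrict (Literature.Analysis.FluidPDE.parabolicCylinder r (0 : ℝ × EuclideanSpace ℝ (Fin 3)))) < ⊤

-- `QuantisedOrder` holds: proved by `Summit.NavierStokesRegularity.NavierStokesRegularity.Theorems.quantisedSymmetry_quantisedOrder_proof` (its module imports this route file, so no `_holds` link can be stated here).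

/-- item stmt-NavierStokesRegularity-0153 · support · rank 9 · closed · proved by Summit.NavierStokesRegularity.NavierStokesRegularity.Theorems.adiabaticEddy_clayUniqueness_proof @ bd26efe366a2 (prover) · by planner
sources: Fefferman2000, Prodi1959, Serrin1963
Fefferman's class (A) = jointly C^∞ on ℝ³×[0,∞) + sup_t ∫|u|² < ∞; no energy inequality, no decay of
∇u, no integrability in LPS scales is assumed. Claim: such (u,p) coincides on [0,T) with any
Leray–Hopf classical solution v from the same rapidly decaying datum. Expected route: smoothness +
bounded energy ⇒ u is a distributional solution with locally finite dissipation?? (NOT automatic: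
∫∫|∇u|² may be infinite) — this is exactly the delicate point; alternatives: Liouville-type control
of the pressure (p harmonic part must be affine ⇒ excluded by bounded energy), then local energy
inequality, then weak–strong uniqueness (Prodi 1959, Serrin 1963) against v which is in every LPS
class on compacts of [0,T). [sources: Prodi1959, Serrin1963, Fefferman2000, LemarieRieusset2002,
RobinsonRodrigoSadowski2016] -/
@[route_item "route-NavierStokesRegularity-QuantisedSymmetry", crux]
def ClayUniqueness : Prop :=
  ∀ ν : ℝ, 0 < ν → ∀ (u₀ : EuclideanSpace ℝ (Fin 3) → EuclideanSpace ℝ (Fin 3)), Literature.Analysis.FluidPDE.HasRapidSpatialDecay u₀ → ∀ (u v : ℝ → EuclideanSpace ℝ (Fin 3) → EuclideanSpace ℝ (Fin 3)) (p q : ℝ → EuclideanSpace ℝ (Fin 3) → ℝ) (T : ℝ), 0 < T → Literature.Analysis.FluidPDE.IsSmoothOnHalfSpace u → Literature.Analysis.FluidPDE.IsSmoothOnHalfSpace p → Literature.Analysis.FluidPDE.IsNavierStokesSolution ν 0 u₀ u p → Literature.Analysis.FluidPDE.HasBoundedEnergy u → Literature.Analysis.FluidPDE.IsClassicalNSSolutionOn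 (Set.Ico 0 T) ν 0 v q → Literature.Analysis.FluidPDE.IsLerayHopfOn T ν 0 u₀ v → v 0 = u₀ → ∀ t ∈ Set.Ico 0 T, u t = v t

/-- `ClayUniqueness` holds: proved by `Summit.NavierStokesRegularity.NavierStokesRegularity.Theorems.adiabaticEddy_clayUniqueness_proof` @ bd26efe366a2. -/
theorem ClayUniqueness_holds : ClayUniqueness := _root_.Summit.NavierStokesRegularity.NavierStokesRegularity.Theorems.adiabaticEddy_clayUniqueness_proof

/-- item stmt-NavierStokesRegularity-1408 · support · rank 9 · closed · proved by Summit.NavierStokesRegularity.NavierStokesRegularity.Theorems.quantisedSymmetry_liouvilleKillsProfile_proof (prover) · by planner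
sources: KNSS2009, AlbrittonBarker2019, ChaeWolf2017RemovingDSS
[support] GLUE making #3 the exact kill switch of #2: PolyhedralTypeILiouville →
¬PolyhedralDssProfileExists. Proof route: given the profile u (λ-DSS, Type-I decay C₀,
G-equivariant, ancient mild), ũ(t,x) := u(t−1,x) is ancient mild
(Literature.Analysis.FluidPDE.IsMildNSSolutionBetween.comp_add_right), bounded by C₀ on (−∞,0)
(|u(t−1,x)| ≤ C₀/√(1−t) ≤ C₀), has measurable slices, Type-I decay with the same C₀ (√(1−t) ≥ √(−t))
and is G-equivariant; #3 gives ũ(t) = 0 a.e. for all t<0, i.e. u(s) = 0 a.e. for s < −1; λ-DSS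
(u(t,x) = λ^k u(λ^{2k}t, λ^k x), pick k with λ^{2k}t < −1; linear rescaling preserves null sets)
spreads this to every t<0, contradicting nontriviality. Routine; expected ≤ 150 Lean lines.
[sources: KNSS2009 §1 (scaling/translation invariance of the ancient class); AlbrittonBarker2019;
ChaeWolf2017RemovingDSS] -/
@[route_item "route-NavierStokesRegularity-QuantisedSymmetry"]
def LiouvilleKillsProfile : Prop :=
  (∀ G : Subgroup (EuclideanSpace ℝ (Fin 3) ≃ₗᵢ[ℝ] EuclideanSpace ℝ (Fin 3)), Finite G → (∀ g ∈ G, LinearMap.det (g.toLinearEquiv : EuclideanSpace ℝ (Fin 3) →ₗ[ℝ] EuclideanSpace ℝ (Fin 3)) = 1) → (∀ V : Submodule ℝ (EuclideanSpace ℝ (Fin 3)), (∀ g ∈ G, ∀ v ∈ V, g v ∈ V) → V = ⊥ ∨ V = ⊤) → ∀ u : ℝ → EuclideanSpace ℝ (Fin 3) → EuclideanSpace ℝ (Fin 3), Literature.Analysis.FluidPDE.IsBoundedAncientMildSolution 1 u → (∀ t < 0, AEStronglyMeasurable (u t) volume) → (∃ C₀ : ℝ, Literature.Analysis.FluidPDE.HasTypeIDecay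 C₀ u) → (∀ g ∈ G, ∀ t x, u t (g x) = g (u t x)) → ∀ t < 0, u t =ᵐ[volume] 0) → ¬ (∃ G : Subgroup (EuclideanSpace ℝ (Fin 3) ≃ₗᵢ[ℝ] EuclideanSpace ℝ (Fin 3)), Finite G ∧ (∀ g ∈ G, LinearMap.det (g.toLinearEquiv : EuclideanSpace ℝ (Fin 3) →ₗ[ℝ] EuclideanSpace ℝ (Fin 3)) = 1) ∧ (∀ V : Submodule ℝ (EuclideanSpace ℝ (Fin 3)), (∀ g ∈ G, ∀ v ∈ V, g v ∈ V) → V = ⊥ ∨ V = ⊤) ∧ ∃ c : ℝ, 1 < c ∧ ∃ u : ℝ → EuclideanSpace ℝ (Fin 3) → EuclideanSpace ℝ (Fin 3), Literature.Analysis.FluidPDE.IsAncientMildSolution 1 u ∧ (∀ t < 0, AEStronglyMeasurable (u t) volume) ∧ Literature.Analysis.FluidPDE.IsDiscretelySelfSimilar c u ∧ (∃ C₀ : ℝ, Literature.Analysis.FluidPDE.HasTypeIDecay C₀ u) ∧ (∀ g ∈ G, ∀ t x, u t (g x) = g (u t x)) ∧ ¬ (∀ t < 0, u t =ᵐ[volume]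 0))

-- `LiouvilleKillsProfile` holds: proved by `Summit.NavierStokesRegularity.NavierStokesRegularity.Theorems.quantisedSymmetry_liouvilleKillsProfile_proof` (its module imports this route file, so no `_holds` link can be stated here).

-- earlier Assembly (stmt-NavierStokesRegularity-1409, replaced 2026-08-15T17:00:05Z -> stmt-NavierStokesRegularity-11294): retired by None — (∃ G : Subgroup (EuclideanSpace ℝ (Fin 3) ≃ₗᵢ[ℝ] EuclideanSpace ℝ (Fin 3)), Finite G ∧ (∀ g ∈ G, LinearMap.det (g.toLinearEquiv : EuclideanSpace ℝ (Fin 3) →ₗ[ℝ] EuclideanSpace ℝ (Fin 3)) = 1) ∧ (∀ V : Submodule ℝ (EuclideanSpace ℝ (Fin 3)), (∀ g ∈ G, ∀ v ∈ V, g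
/-- item stmt-NavierStokesRegularity-11294 · assembly · rank 1 · closed · proved by Summit.NavierStokesRegularity.NavierStokesRegularity.Theorems.quantisedSymmetry_assembly_proof (prover) · by planner
sources: Fefferman2000, Tsai2018
[assembly] PolyhedralDssProfileExists → PolyhedralTruncationBridge → ClayUniqueness →
¬NavierStokesRegularity (rev 2): literally the type of the deciding theorem `closes` (Clay (A)
applied to the datum u 0 of the G-equivariantly truncated profile gives a global smooth
bounded-energy solution; ClayUniqueness (X5b) glues it to the blowing-up solution on [0,T); read as
a classical solution on Ici 0 and restricted to [0,T+1) it is a smooth extension past T,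
contradicting maximality — the Literature.NS.blowup_assembly argument inlined so the cone does not
grow). `theorem Assembly_holds : Assembly := closes`. [sources: Fefferman2000 (A);
BealeKatoMajda1984 §1 (maximal interval); Tsai2018] -/
@[route_item "route-NavierStokesRegularity-QuantisedSymmetry"]
def Assembly : Prop :=
  PolyhedralDssProfileExists → PolyhedralTruncationBridge → ClayUniqueness → ¬ _root_.NavierStokesRegularity

-- `Assembly` holds: proved by `Summit.NavierStokesRegularity.NavierStokesRegularity.Theorems.quantisedSymmetry_assembly_proof` (its module imports this route file, so no `_holds` link can be stated here).

-- records of items no longer active in this route (dropped / restated):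
-- earlier DssTruncationBridge (stmt-NavierStokesRegularity-0901, replaced 2026-08-15T16:28:21Z -> stmt-NavierStokesRegularity-10889): retired by None — ¬ Literature.Analysis.FluidPDE.TypeIDSSLiouvilleConjecture → ∃ ν : ℝ, 0 < ν ∧ ∃ T : ℝ, 0 < T ∧ ∃ (u : ℝ → EuclideanSpace ℝ (Fin 3) → EuclideanSpace ℝ (Fin 3)) (p : ℝ → EuclideanSpace ℝ (Fin 3) → ℝ), Literature.Analysis.FluidPDE.IsMaximalSmoothSolutio

/-! D-0027 §2.1 — DECIDING THEOREM (planner-authored via `route open/edit --closes-file`; by planner-rbadge-NavierStokesRegularity-Quantise-2bc14d0a-g2-0 2026-08-15T17:07:35Z):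
its hypotheses are this route's items and its conclusion the sub-problem Statement (glue_lint), and it elaborates with this file. -/

@[closes "route-NavierStokesRegularity-QuantisedSymmetry"] theorem closes (hX : PolyhedralDssProfileExists) (hB : PolyhedralTruncationBridge) (hU : ClayUniqueness) : ¬ _root_.NavierStokesRegularity := by
  rintro hA
  obtain ⟨G, hfin, hdet, hirr, c, hc, w, hanc, hmeas, hdss, hdec, heqv, hnt⟩ := hX
  obtain ⟨ν, hν, T, hT, u, p, ⟨hcl, hmax⟩, hLH, hdecay⟩ :=
    hB G hfin hdet hirr c hc w hanc hmeas hdss hdec heqv hnt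
  have h0 : (0 : ℝ) ∈ Set.Ico 0 T := ⟨le_rfl, hT⟩
  obtain ⟨u', p', hu', hp', hns, hbe⟩ :=
    hA ν hν (u 0) (hcl.contDiff_velocity h0) (hcl.divFree 0 h0) hdecay
  have heq : ∀ t ∈ Set.Ico 0 T, u' t = u t :=
    hU ν hν (u 0) hdecay u' u p' p T hT hu' hp' hns hbe hcl hLH rfl
  have hcl' : Literature.Analysis.FluidPDE.IsClassicalNSSolutionOn (Set.Ici 0) ν 0 u' p' :=
    ⟨hu', hp', fun t ht x => hns.momentum t ht x, fun t ht => hns.divFree t ht⟩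
  refine hmax ⟨T + 1, by linarith, u', p', ?_, heq⟩
  exact hcl'.mono (fun t ht => ht.1) (uniqueDiffOn_Ico 0 (T + 1))

end Summit.NavierStokesRegularity.NavierStokesRegularity.Theses.QuantisedSymmetry
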